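/-
Copyright (c) 2026. All rights reserved.
Released under Apache 2.0 license as described in the file LICENSE.
Authors: abc-iut cell, wave-3 prover seat abc-iut-L6-d4 (L3 ROW UnivCoverSimplyConnected).
-/
import Mathlib.Combinatorics.SimpleGraph.Acyclic
import Literature.GroupTheory.CombinatorialGroupTheory.FreeGroupPrependLetter
import Literature.AnabelianGeometry.SemiGraphs.SubdivisionLemmas
import Literature.AnabelianGeometry.SemiGraphs.UniversalCovering
import Literature.AnabelianGeometry.SemiGraphs.FundamentalGroupImmersions
import HarnessLib

/-!
# The universal graph-covering of a semi-graph has no cycles ([SemiAnbd] §1 p. 15)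

Mochizuki, *Semi-graphs of anabelioids*, Publ. RIMS **42** (2006), §1 p. 15 ("universal
graph-coverings") and Prop. 3.6 p. 38 (`𝒢_{∞,i} → 𝒢_i` "determined by the universal graph-covering of
the underlying semi-graph").  For the universal graph-covering `𝔾̃ = G.univCover c₀ → 𝔾` constructed
by abc-iut-L3-t9 (`UniversalCovering.lean`, p407189: vertices / edges over `v` / `e` = morphisms
`c₀ ⟶ v`, `c₀ ⟶ e` of the fundamental groupoid; the branch `b` of `(e, p)` abuts to `(v, p ≫ b)`) we
prove the first half of "`𝔾̃` is a tree" in the sense of abc-iut-L3-t1's `SemiGraph.IsTree` (the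
barycentric subdivision `SemiGraph.subdivision` is a tree):

* `SemiGraph.univCover_subdivision_isAcyclic` — for EVERY semi-graph `G` and every base component
  `c₀`, the subdivision of `G.univCover c₀` is ACYCLIC (no hypothesis: open branches are pendant
  half-edges, and `univCover c₀` only covers the component of `c₀`).

Route (Serre, *Trees*, I §3; Stallings §2): grade the nodes of `𝔾̃` by the reduced length
`n(q) := ‖W q‖` of the path class carried by a vertex/edge `(x, q)` — `W` = abc-iut-L3-d5's word
functor to the free group on all arrows (`FreeGroupoidWords.lean`), `‖·‖ = FreeGroup.norm` — giving
height `2·n(q)` to vertex and edge nodes and `n(p) + n(p ≫ b)` (resp. `2·n(p) + 1`) to the node of a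
branch `b` of `(e, p)` abutting to `(v, p ≫ b)` (resp. abutting to nothing).  Prepending one letter
changes the reduced length by exactly one, and decreases it iff the reduced word starts with the
inverse letter (`FreeGroup.norm_mk_singleton_mul`, file `FreeGroupPrependLetter.lean`; the incidence
inversion lemmas are the tree's `SubdivisionLemmas.lean`); hence adjacent nodes have heights differing by
one and every node has AT MOST ONE lower neighbour — and a graph graded like that has no cycle (a
node of maximal height on a cycle would have two distinct lower neighbours).  The companion file
`UniversalCoveringTree.lean` adds connectedness (every node descends to the root) and `IsTree`.

Proof-only (no definitions).  Classical facts; nothing here bears on any disputed claim.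
-/

namespace Literature.AnabelianGeometry.SemiGraphs

open CategoryTheory Quiver
open Literature.GroupTheory.CombinatorialGroupTheory
open Literature.GroupTheory.CombinatorialGroupTheory.FreeGroupoidWords

universe u

/-! ### §1 Graded graphs with unique lower neighbours have no cycles -/

section Height

variable {V : Type*} {S : SimpleGraph V}

/-- A simple graph carrying a height function along whose edges the height changes by exactly one
and such that every vertex has at most one LOWER neighbour is acyclic (look at a vertex of maximal
height on a cycle).  File-private generic lemma. [folklore] -/
private theorem isAcyclic_of_height (h : V → ℕ)
    (hstep : ∀ ⦃x y : V⦄, S.Adj x y → h x = h y + 1 ∨ h y = h x + 1)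
    (huniq : ∀ ⦃x y z : V⦄, S.Adj x y → S.Adj x z → h y < h x → h z < h x → y = z) :
    S.IsAcyclic := by
  intro v c hc
  have hlen : 3 ≤ c.length := hc.three_le_length
  -- an index of maximal height on the cycle
  obtain ⟨i₀, hi₀, hmax⟩ := Finset.exists_max_image (Finset.range c.length)
    (fun j => h (c.getVert j)) ⟨0, Finset.mem_range.mpr (by omega)⟩
  rw [Finset.mem_range] at hi₀
  have hmax' : ∀ j, h (c.getVert j) ≤ h (c.getVert i₀) := by
    intro j
    by_cases hj : j < c.length
    · exact hmax j (Finset.mem_range.mpr hj)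
    · have hj0 : c.getVert j = c.getVert 0 := by
        rw [c.getVert_of_length_le (not_lt.mp hj), c.getVert_zero]
      rw [hj0]
      exact hmax 0 (Finset.mem_range.mpr (by omega))
  have hinj := hc.getVert_injOn'
  -- the successor on the cycle is lower
  have hnext : S.Adj (c.getVert i₀) (c.getVert (i₀ + 1)) := c.adj_getVert_succ hi₀
  have hlt_next : h (c.getVert (i₀ + 1)) < h (c.getVert i₀) := by
    have := hmax' (i₀ + 1)
    rcases hstep hnext with h1 | h1 <;> omega
  by_cases hi : i₀ = 0
  · subst hi
    -- the predecessor of the base point is `getVert (length - 1)`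
    have hprev : S.Adj (c.getVert 0) (c.getVert (c.length - 1)) := by
      have h1 := c.adj_getVert_succ (show c.length - 1 < c.length by omega)
      rw [show c.length - 1 + 1 = c.length by omega, c.getVert_length] at h1
      rw [c.getVert_zero]
      exact h1.symm
    have hlt_prev : h (c.getVert (c.length - 1)) < h (c.getVert 0) := by
      have := hmax' (c.length - 1)
      rcases hstep hprev with h1 | h1 <;> omega
    have heq := huniq hnext hprev hlt_next hlt_prev
    have := hinj (show (0 : ℕ) + 1 ∈ {i | i ≤ c.length - 1} by
        simp only [Set.mem_setOf_eq]; omega)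
      (show c.length - 1 ∈ {i | i ≤ c.length - 1} by simp only [Set.mem_setOf_eq]; omega) heq
    omega
  · have hprev : S.Adj (c.getVert i₀) (c.getVert (i₀ - 1)) := by
      have h1 := c.adj_getVert_succ (show i₀ - 1 < c.length by omega)
      rw [show i₀ - 1 + 1 = i₀ by omega] at h1
      exact h1.symm
    have hlt_prev : h (c.getVert (i₀ - 1)) < h (c.getVert i₀) := by
      have := hmax' (i₀ - 1)
      rcases hstep hprev with h1 | h1 <;> omega
    have heq := huniq hnext hprev hlt_next hlt_prev
    by_cases hlast : i₀ + 1 = c.length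
    · have h0 : c.getVert (i₀ + 1) = c.getVert 0 := by
        rw [hlast, c.getVert_length, c.getVert_zero]
      rw [h0] at heq
      have := hinj (show (0 : ℕ) ∈ {i | i ≤ c.length - 1} by
          simp only [Set.mem_setOf_eq]; omega)
        (show i₀ - 1 ∈ {i | i ≤ c.length - 1} by simp only [Set.mem_setOf_eq]; omega) heq
      omega
    · have := hinj (show i₀ + 1 ∈ {i | i ≤ c.length - 1} by
          simp only [Set.mem_setOf_eq]; omega)
        (show i₀ - 1 ∈ {i | i ≤ c.length - 1} by simp only [Set.mem_setOf_eq]; omega) heq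
      omega

end Height

namespace SemiGraph

/-! ### §4 Bookkeeping for the universal graph-covering -/

section UnivCover

variable (G : SemiGraph.{u}) (c₀ : G.CatCarrier)

/-- A branch of `𝔾̃` over a branch of `𝔾` abutting to no vertex abuts to no vertex.
[cite: MochizukiSemiAnbd2006, §1 p.15] -/
theorem univCover_abuts_eq_none {bt : (G.univCover c₀).Branch} (h : G.abuts bt.2.1 = none) :
    (G.univCover c₀).abuts bt = none := by
  obtain ⟨⟨e, p⟩, ⟨b, hb⟩⟩ := bt
  exact G.univCover_abuts_of_none c₀ e p b hb h

/-- A branch of `𝔾̃` over a branch `b` of `e` abutting to `v` abuts to `(v, p ≫ b)`.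
[cite: MochizukiSemiAnbd2006, §1 p.15] -/
theorem univCover_abuts_eq_some {bt : (G.univCover c₀).Branch} {v : G.Vertex}
    (h : G.abuts bt.2.1 = some v) :
    (G.univCover c₀).abuts bt = some ⟨v, bt.1.2 ≫ G.brArrow bt.2.1 bt.1.1 v bt.2.2 h⟩ := by
  obtain ⟨⟨e, p⟩, ⟨b, hb⟩⟩ := bt
  exact G.univCover_abuts_of_abuts c₀ e p b hb v h

/-- Conversely, if a branch of `𝔾̃` abuts to `vt` then the underlying branch abuts to the underlying
vertex and `vt = (v, p ≫ b)`. [cite: MochizukiSemiAnbd2006, §1 p.15] -/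
theorem univCover_abuts_inv {bt : (G.univCover c₀).Branch} {vt : (G.univCover c₀).Vertex}
    (h : (G.univCover c₀).abuts bt = some vt) :
    ∃ hv : G.abuts bt.2.1 = some vt.1, vt = ⟨vt.1, bt.1.2 ≫ G.brArrow bt.2.1 bt.1.1 vt.1 bt.2.2 hv⟩ := by
  have hv : G.abuts bt.2.1 = some vt.1 := (G.univCoverProj c₀).abuts_branchMap bt vt h
  refine ⟨hv, ?_⟩
  rw [G.univCover_abuts_eq_some c₀ hv] at h
  exact (Option.some.inj h).symm

/-- The word of the arrow `b : e → v` of `Cat(𝔾)` is a single positive letter whose underlying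
branch (abc-iut-L3-d5's `arrowBranch`) is `b`. [cite: MochizukiSemiAnbd2006, Def. 2.11 p.32] -/
theorem exists_letter_brArrow (b : G.Branch) (e : G.Edge) (v : G.Vertex) (he : G.edgeOf b = e)
    (hv : G.abuts b = some v) :
    ∃ L : Letter G.CatCarrier, arrowBranch L = b ∧
      (wordFunctor G.CatCarrier).map (G.brArrow b e v he hv) = FreeGroup.mk [(L, true)] :=
  ⟨⟨(show G.CatCarrier from Sum.inr e), (show G.CatCarrier from Sum.inl v),
      (show SemiGraph.CatArrow (G := G) (Sum.inr e) (Sum.inl v) from ⟨b, he, hv⟩)⟩, rfl,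
    wordFunctor_map_homMk_toPath (V := G.CatCarrier)
      (Sum.inl (show SemiGraph.CatArrow (G := G) (Sum.inr e) (Sum.inl v) from ⟨b, he, hv⟩) :
        (show Symmetrify G.CatCarrier from Sum.inr e) ⟶ (show Symmetrify G.CatCarrier from Sum.inl v))⟩

/-- **The reduced length along a branch.**  For `p : c₀ ⟶ e` and a branch `b : e → v` of `Cat(𝔾)`
(letter `L`), either `‖W(p ≫ b)‖ = ‖W p‖ + 1` and the reduced word of `p ≫ b` is `(L,+)` prepended to
that of `p`, or `‖W(p ≫ b)‖ + 1 = ‖W p‖` and the reduced word of `p` starts with `(L,−)` (for any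
decidable equality on letters, e.g. the classical one). [cite: Stallings1983, §2.2-2.3 p.553] -/
theorem norm_comp_brArrow [DecidableEq (Letter G.CatCarrier)] (b : G.Branch) (e : G.Edge) (v : G.Vertex)
    (he : G.edgeOf b = e)
    (hv : G.abuts b = some v) (p : G.basept c₀ ⟶ G.basept (Sum.inr e)) :
    ∃ L : Letter G.CatCarrier, arrowBranch L = b ∧
      ((FreeGroup.norm ((wordFunctor G.CatCarrier).map (p ≫ G.brArrow b e v he hv)) =
          FreeGroup.norm ((wordFunctor G.CatCarrier).map p) + 1 ∧
        FreeGroup.toWord ((wordFunctor G.CatCarrier).map (p ≫ G.brArrow b e v he hv)) =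
          (L, true) :: FreeGroup.toWord ((wordFunctor G.CatCarrier).map p)) ∨
      (FreeGroup.norm ((wordFunctor G.CatCarrier).map (p ≫ G.brArrow b e v he hv)) + 1 =
          FreeGroup.norm ((wordFunctor G.CatCarrier).map p) ∧
        ∃ tl, FreeGroup.toWord ((wordFunctor G.CatCarrier).map p) = (L, false) :: tl)) := by
  obtain ⟨L, hL, hW⟩ := G.exists_letter_brArrow b e v he hv
  refine ⟨L, hL, ?_⟩
  rw [Functor.map_comp, SingleObj.comp_as_mul, hW]
  exact FreeGroup.norm_mk_singleton_mul (L, true) _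

end UnivCover

/-! ### §5 The universal graph-covering has no cycles -/

/-- **The barycentric subdivision of the universal graph-covering `G.univCover c₀` is acyclic**, for
every semi-graph `G` and every base component `c₀` (the "tree" of [SemiAnbd] §1 p. 15, Prop. 3.6
p. 38, acyclicity half; connectedness and `IsTree` are in `UniversalCoveringTree.lean`).
[cite: MochizukiSemiAnbd2006, §1 p.15] -/
theorem univCover_subdivision_isAcyclic (G : SemiGraph.{u}) (c₀ : G.CatCarrier) :
    (G.univCover c₀).subdivision.IsAcyclic := by
  classical
  -- the height function
  set H : (G.univCover c₀).Node → ℕ := fun x =>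
    Sum.elim (fun vt : (G.univCover c₀).Vertex =>
        2 * FreeGroup.norm ((wordFunctor G.CatCarrier).map vt.2))
      (Sum.elim
        (fun et : (G.univCover c₀).Edge => 2 * FreeGroup.norm ((wordFunctor G.CatCarrier).map et.2))
        (fun bt : (G.univCover c₀).Branch => ((G.univCover c₀).abuts bt).elim
          (2 * FreeGroup.norm ((wordFunctor G.CatCarrier).map bt.1.2) + 1)
          (fun vt => FreeGroup.norm ((wordFunctor G.CatCarrier).map bt.1.2) +
            FreeGroup.norm ((wordFunctor G.CatCarrier).map vt.2)))) x with hH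
  have HV : ∀ vt : (G.univCover c₀).Vertex,
      H (Sum.inl vt) = 2 * FreeGroup.norm ((wordFunctor G.CatCarrier).map vt.2) := fun _ => rfl
  have HE : ∀ et : (G.univCover c₀).Edge,
      H (Sum.inr (Sum.inl et)) = 2 * FreeGroup.norm ((wordFunctor G.CatCarrier).map et.2) :=
    fun _ => rfl
  have HB0 : ∀ bt : (G.univCover c₀).Branch, (G.univCover c₀).abuts bt = none →
      H (Sum.inr (Sum.inr bt)) = 2 * FreeGroup.norm ((wordFunctor G.CatCarrier).map bt.1.2) + 1 := by
    intro bt h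
    show ((G.univCover c₀).abuts bt).elim _ _ = _
    rw [h]
    rfl
  have HB1 : ∀ (bt : (G.univCover c₀).Branch) (vt : (G.univCover c₀).Vertex),
      (G.univCover c₀).abuts bt = some vt →
      H (Sum.inr (Sum.inr bt)) = FreeGroup.norm ((wordFunctor G.CatCarrier).map bt.1.2) +
        FreeGroup.norm ((wordFunctor G.CatCarrier).map vt.2) := by
    intro bt vt h
    show ((G.univCover c₀).abuts bt).elim _ _ = _
    rw [h]
    rfl
  -- the vertex node a branch node abuts to carries the class `p ≫ b`
  have HVB : ∀ (bt : (G.univCover c₀).Branch) (vt : (G.univCover c₀).Vertex),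
      (G.univCover c₀).abuts bt = some vt →
      ∃ hv : G.abuts bt.2.1 = some vt.1,
        FreeGroup.norm ((wordFunctor G.CatCarrier).map vt.2) =
          FreeGroup.norm ((wordFunctor G.CatCarrier).map
            (bt.1.2 ≫ G.brArrow bt.2.1 bt.1.1 vt.1 bt.2.2 hv)) ∧
        FreeGroup.toWord ((wordFunctor G.CatCarrier).map vt.2) =
          FreeGroup.toWord ((wordFunctor G.CatCarrier).map
            (bt.1.2 ≫ G.brArrow bt.2.1 bt.1.1 vt.1 bt.2.2 hv)) := by
    intro bt vt h
    obtain ⟨hv, hvt⟩ := G.univCover_abuts_inv c₀ h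
    refine ⟨hv, ?_, ?_⟩
    · exact congrArg (fun w : (G.univCover c₀).Vertex =>
        FreeGroup.norm ((wordFunctor G.CatCarrier).map w.2)) hvt
    · exact congrArg (fun w : (G.univCover c₀).Vertex =>
        FreeGroup.toWord ((wordFunctor G.CatCarrier).map w.2)) hvt
  -- the height changes by one along every incidence
  have hrel : ∀ a b : (G.univCover c₀).Node, (G.univCover c₀).NodeRel a b →
      H a = H b + 1 ∨ H b = H a + 1 := by
    intro a b hab
    cases hab with
    | edge_branch bt =>
      have hx : H (Sum.inr (Sum.inl ((G.univCover c₀).edgeOf bt))) =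
          2 * FreeGroup.norm ((wordFunctor G.CatCarrier).map bt.1.2) := rfl
      rw [hx]
      rcases habs : G.abuts bt.2.1 with _ | v
      · rw [HB0 bt (G.univCover_abuts_eq_none c₀ habs)]
        exact Or.inr rfl
      · rw [HB1 bt _ (G.univCover_abuts_eq_some c₀ habs)]
        dsimp only
        obtain ⟨L, -, ⟨h1, -⟩ | ⟨h1, -⟩⟩ :=
          G.norm_comp_brArrow c₀ bt.2.1 bt.1.1 v bt.2.2 habs bt.1.2
        · right; omega
        · left; omega
    | branch_vertex bt vt h =>
      rw [HB1 bt vt h, HV vt]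
      obtain ⟨hv, hn, -⟩ := HVB bt vt h
      rw [hn]
      obtain ⟨L, -, ⟨h1, -⟩ | ⟨h1, -⟩⟩ :=
        G.norm_comp_brArrow c₀ bt.2.1 bt.1.1 vt.1 bt.2.2 hv bt.1.2
      · right; omega
      · left; omega
  refine isAcyclic_of_height H ?_ ?_
  · -- heights of adjacent nodes differ by one
    intro x y hxy
    rw [subdivision_adj_iff] at hxy
    obtain h | h := hxy
    · exact hrel x y h
    · exact (hrel y x h).symm
  · -- every node has at most one lower neighbour
    intro x y z hxy hxz hy hz
    rcases x with vt | et | bt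
    · -- a vertex node `(v, q)`: the reduced word of `q` ends with the unique lower branch
      rw [subdivision_adj_inl_iff] at hxy hxz
      obtain ⟨b₁, hb₁, rfl⟩ := hxy
      obtain ⟨b₂, hb₂, rfl⟩ := hxz
      rw [HB1 b₁ vt hb₁, HV] at hy
      rw [HB1 b₂ vt hb₂, HV] at hz
      obtain ⟨hv₁, hn₁, hw₁⟩ := HVB b₁ vt hb₁
      obtain ⟨hv₂, hn₂, hw₂⟩ := HVB b₂ vt hb₂
      obtain ⟨L₁, hL₁, ⟨-, hW₁⟩ | ⟨h1, -⟩⟩ :=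
        G.norm_comp_brArrow c₀ b₁.2.1 b₁.1.1 vt.1 b₁.2.2 hv₁ b₁.1.2
      swap
      · exfalso; omega
      obtain ⟨L₂, hL₂, ⟨-, hW₂⟩ | ⟨h2, -⟩⟩ :=
        G.norm_comp_brArrow c₀ b₂.2.1 b₂.1.1 vt.1 b₂.2.2 hv₂ b₂.1.2
      swap
      · exfalso; omega
      -- the two descriptions of the reduced word of `q` coincide
      have hcons := (hw₁.trans hW₁).symm.trans (hw₂.trans hW₂)
      obtain ⟨hL, htl⟩ := List.cons_eq_cons.mp hcons
      have hb : b₁.2.1 = b₂.2.1 := by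
        rw [← hL₁, ← hL₂, show L₁ = L₂ from congrArg Prod.fst hL]
      -- unpack the two branch nodes and substitute
      obtain ⟨⟨e₁, p₁⟩, ⟨bb₁, hbb₁⟩⟩ := b₁
      obtain ⟨⟨e₂, p₂⟩, ⟨bb₂, hbb₂⟩⟩ := b₂
      change bb₁ = bb₂ at hb
      change G.edgeOf bb₁ = e₁ at hbb₁
      change G.edgeOf bb₂ = e₂ at hbb₂
      change FreeGroup.toWord ((wordFunctor G.CatCarrier).map p₁) =
        FreeGroup.toWord ((wordFunctor G.CatCarrier).map p₂) at htl
      subst hb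
      subst hbb₁
      subst hbb₂
      have hW : (wordFunctor G.CatCarrier).map p₁ = (wordFunctor G.CatCarrier).map p₂ :=
        @FreeGroup.toWord_injective _ _ _ _ htl
      have hp : p₁ = p₂ := wordFunctor_map_injective (V := G.CatCarrier) hW
      subst hp
      rfl
    · -- an edge node `(e, p)`: the reduced word of `p` starts with `(b,−)` for a lower branch `b`
      rw [subdivision_adj_edge_iff] at hxy hxz
      obtain ⟨b₁, hb₁, rfl⟩ := hxy
      obtain ⟨b₂, hb₂, rfl⟩ := hxz
      rw [HE] at hy hz
      obtain ⟨e, p⟩ := et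
      obtain ⟨et₁, ⟨bb₁, hbb₁⟩⟩ := b₁
      obtain ⟨et₂, ⟨bb₂, hbb₂⟩⟩ := b₂
      change et₁ = ⟨e, p⟩ at hb₁
      change et₂ = ⟨e, p⟩ at hb₂
      subst hb₁
      subst hb₂
      change G.edgeOf bb₁ = e at hbb₁
      change G.edgeOf bb₂ = e at hbb₂
      -- both branches abut: an open branch node is higher than its edge node
      rcases hab₁ : G.abuts bb₁ with _ | v₁
      · rw [HB0 _ (G.univCover_abuts_of_none c₀ e p bb₁ hbb₁ hab₁)] at hy
        exfalso
        change 2 * FreeGroup.norm ((wordFunctor G.CatCarrier).map p) + 1 <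
          2 * FreeGroup.norm ((wordFunctor G.CatCarrier).map p) at hy
        omega
      rcases hab₂ : G.abuts bb₂ with _ | v₂
      · rw [HB0 _ (G.univCover_abuts_of_none c₀ e p bb₂ hbb₂ hab₂)] at hz
        exfalso
        change 2 * FreeGroup.norm ((wordFunctor G.CatCarrier).map p) + 1 <
          2 * FreeGroup.norm ((wordFunctor G.CatCarrier).map p) at hz
        omega
      rw [HB1 _ _ (G.univCover_abuts_of_abuts c₀ e p bb₁ hbb₁ v₁ hab₁)] at hy
      rw [HB1 _ _ (G.univCover_abuts_of_abuts c₀ e p bb₂ hbb₂ v₂ hab₂)] at hz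
      change FreeGroup.norm ((wordFunctor G.CatCarrier).map p) +
          FreeGroup.norm ((wordFunctor G.CatCarrier).map (p ≫ G.brArrow bb₁ e v₁ hbb₁ hab₁)) <
        2 * FreeGroup.norm ((wordFunctor G.CatCarrier).map p) at hy
      change FreeGroup.norm ((wordFunctor G.CatCarrier).map p) +
          FreeGroup.norm ((wordFunctor G.CatCarrier).map (p ≫ G.brArrow bb₂ e v₂ hbb₂ hab₂)) <
        2 * FreeGroup.norm ((wordFunctor G.CatCarrier).map p) at hz
      obtain ⟨L₁, hL₁, ⟨h1, -⟩ | ⟨-, tl₁, htl₁⟩⟩ := G.norm_comp_brArrow c₀ bb₁ e v₁ hbb₁ hab₁ p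
      · exfalso; omega
      obtain ⟨L₂, hL₂, ⟨h2, -⟩ | ⟨-, tl₂, htl₂⟩⟩ := G.norm_comp_brArrow c₀ bb₂ e v₂ hbb₂ hab₂ p
      · exfalso; omega
      obtain ⟨hL, -⟩ := List.cons_eq_cons.mp (htl₁.symm.trans htl₂)
      have hb : bb₁ = bb₂ := by
        rw [← hL₁, ← hL₂, show L₁ = L₂ from congrArg Prod.fst hL]
      subst hb
      rfl
    · -- a branch node: its edge node and its vertex node are never both lower
      rw [subdivision_adj_branch_iff] at hxy hxz
      have hx0 : H (Sum.inr (Sum.inl ((G.univCover c₀).edgeOf bt))) =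
          2 * FreeGroup.norm ((wordFunctor G.CatCarrier).map bt.1.2) := rfl
      rcases hxy with rfl | ⟨vt₁, hvt₁, rfl⟩ <;> rcases hxz with rfl | ⟨vt₂, hvt₂, rfl⟩
      · rfl
      · exfalso
        rw [HB1 bt vt₂ hvt₂] at hy hz
        rw [HV] at hz
        rw [hx0] at hy
        omega
      · exfalso
        rw [HB1 bt vt₁ hvt₁] at hy hz
        rw [HV] at hy
        rw [hx0] at hz
        omega
      · rw [hvt₁] at hvt₂
        cases hvt₂
        rfl

end SemiGraph

end Literature.AnabelianGeometry.SemiGraphs
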